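import Summits.KontsevichZagierPeriods.KontsevichZagierPeriods.Theorems.RootDecompRelativeModAbsoluteCylLogSplitP04

/-! # `RootDecompRelativeModAbsoluteCylLogSplitP05` — part 5/25 of the mechanical ≤330-line split of `CylLogSplit.lean`
(split by the decomp-kz census seat for landing; mathematics unchanged; part 5 continues part 4). -/

noncomputable section
open Set MeasureTheory Filter Topology
open scoped BigOperators
open Literature.NumberTheory.Transcendental Literature.ModelTheory.ExponentialFields

namespace Summit.KontsevichZagierPeriods.RootDecompRelativeModAbsolute.Rung30571

namespace RegularisedLogLayer

namespace CylLog
variable {b : ℕ}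

/-- (T2) The polynomial band folds to the base: `[S] − [N] − [G, d(Φ(q) − Φ(p))] ∈ relations`,
`Φ(s) = polyLog m (us) − polyLog m s` (rules 1b and 3). -/
theorem polyBand_fold {b m : ℕ} {G : Set (Fin b → ℝ)} {d u p q : (Fin b → ℝ) → ℝ}
    (hd : IsSemialgebraicFunOn ℚ G d) (hu : IsSemialgebraicFunOn ℚ G u)
    (hp : IsSemialgebraicFunOn ℚ G p) (hq : IsSemialgebraicFunOn ℚ G q)
    (hp0 : ∀ x ∈ G, 0 < p x) (hpq : ∀ x ∈ G, p x ≤ q x) (hu0 : ∀ x ∈ G, 0 < u x)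
    (S N : KZ.IntegralRep (b + 1)) (Bφ : KZ.IntegralRep b) (hSd : S.domain = KZlog.band G p q)
    (hSi : EqOn S.integrand
      (fun z => d (Fin.init z) * ((u (Fin.init z) * z (Fin.last b) - 1) ^ m / z (Fin.last b)))
      S.domain)
    (hNd : N.domain = KZlog.band G p q)
    (hNi : EqOn N.integrand
      (fun z => d (Fin.init z) * ((z (Fin.last b) - 1) ^ m / z (Fin.last b))) N.domain)
    (hBd : Bφ.domain = G)
    (hBi : EqOn Bφ.integrand (fun x => d x * ((polyLog m (u x * q x) - polyLog m (q x)) -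
      (polyLog m (u x * p x) - polyLog m (p x)))) Bφ.domain) :
    KZ.of S - KZ.of N - KZ.of Bφ ∈ KZ.relations := by
  have hbpq : IsSemialgebraic ℚ (KZlog.band G p q) := KZlog.isSemialgebraic_band hp hq
  have hSsa : IsSemialgebraicFunOn ℚ (KZlog.band G p q) S.integrand := by
    rw [← hSd]; exact S.isSemialgebraicFunOn_integrand
  have hNsa : IsSemialgebraicFunOn ℚ (KZlog.band G p q) N.integrand := by
    rw [← hNd]; exact N.isSemialgebraicFunOn_integrand
  have hSint : IntegrableOn S.integrand (KZlog.band G p q) := by rw [← hSd]; exact S.integrableOn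
  have hNint : IntegrableOn N.integrand (KZlog.band G p q) := by rw [← hNd]; exact N.integrableOn
  let P : KZ.IntegralRep (b + 1) :=
    { domain := KZlog.band G p q
      integrand := fun z => S.integrand z - N.integrand z
      isSemialgebraic_domain := hbpq
      isSemialgebraicFunOn_integrand := IsSemialgebraicFunOn.sub_holds hSsa hNsa
      integrableOn := hSint.sub hNint }
  have hPrel : KZ.of S - KZ.of N - KZ.of P ∈ KZ.relations :=
    KZ.integrandAddRel_subset_relations ⟨b + 1, S, N, P, by rw [hNd, hSd], by rw [hSd],
      fun z _ => by simp [P], rfl⟩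
  set F : (Fin (b + 1) → ℝ) → ℝ := fun z =>
    d (Fin.init z) * (polyLog m (u (Fin.init z) * z (Fin.last b)) - polyLog m (z (Fin.last b)))
    with hF
  have hband_sub : KZlog.band G p q ⊆ {z : Fin (b + 1) → ℝ | Fin.init z ∈ G} := fun z hz => hz.1
  have hdI : IsSemialgebraicFunOn ℚ (KZlog.band G p q) (fun z => d (Fin.init z)) :=
    hd.comp_init.mono hband_sub hbpq
  have huI : IsSemialgebraicFunOn ℚ (KZlog.band G p q) (fun z => u (Fin.init z)) :=
    hu.comp_init.mono hband_sub hbpq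
  have hsI : IsSemialgebraicFunOn ℚ (KZlog.band G p q) (fun z => z (Fin.last b)) :=
    isSemialgebraicFunOn_apply hbpq (Fin.last b)
  have husI : IsSemialgebraicFunOn ℚ (KZlog.band G p q)
      (fun z => u (Fin.init z) * z (Fin.last b)) := IsSemialgebraicFunOn.mul_holds huI hsI
  have hFsa : IsSemialgebraicFunOn ℚ P.domain F := by
    have h := IsSemialgebraicFunOn.mul_holds hdI (IsSemialgebraicFunOn.sub_holds
      (isSemialgebraicFunOn_polyLog_comp hbpq husI m) (isSemialgebraicFunOn_polyLog_comp hbpq hsI m))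
    exact h.congr fun z _ => by simp [hF]
  have hNL : KZ.of P - KZ.of Bφ ∈ KZ.relations := by
    refine KZ.newtonLeibnizRel_subset_relations ⟨b, P, Bφ, p, q, F, hFsa, ?_, ?_, ?_, ?_,
      ?_, ?_, ?_, rfl⟩
    · rw [hBd]; exact hp
    · rw [hBd]; exact hq
    · rw [hBd]; exact hpq
    · rw [hBd]; rfl
    · intro x _
      have hc : Continuous fun t : ℝ => F (Fin.snoc x t) := by
        simp only [hF, Fin.init_snoc, Fin.snoc_last]
        exact continuous_const.mul (((continuous_polyLog m).comp (continuous_const.mul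
          continuous_id)).sub (continuous_polyLog m))
      exact hc.continuousOn
    · intro x hx t ht
      rw [hBd] at hx
      have hux : 0 < u x := hu0 x hx
      have ht0 : t ≠ 0 := ((hp0 x hx).trans ht.1).ne'
      have hut0 : u x * t ≠ 0 := mul_ne_zero hux.ne' ht0
      have hmem : (Fin.snoc x t : Fin (b + 1) → ℝ) ∈ KZlog.band G p q := by
        rw [KZlog.snoc_mem_band]; exact ⟨hx, Ioo_subset_Icc_self ht⟩
      have hPz : P.integrand (Fin.snoc x t) =
          d x * (((u x * t - 1) ^ m - (-1) ^ m) / (u x * t) * u x -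
            ((t - 1) ^ m - (-1) ^ m) / t) := by
        show S.integrand (Fin.snoc x t) - N.integrand (Fin.snoc x t) = _
        rw [hSi (hSd ▸ hmem), hNi (hNd ▸ hmem)]
        simp only [Fin.init_snoc, Fin.snoc_last]
        field_simp
        ring
      rw [hPz]
      have h1 : HasDerivAt (fun s : ℝ => polyLog m (u x * s))
          (((u x * t - 1) ^ m - (-1) ^ m) / (u x * t) * u x) t := by
        have hlin : HasDerivAt (fun s : ℝ => u x * s) (u x) t := by
          simpa using (hasDerivAt_id t).const_mul (u x)
        exact (hasDerivAt_polyLog m hut0).comp t hlin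
      have h2 := hasDerivAt_polyLog m ht0
      have h3 := (h1.sub h2).const_mul (d x)
      simp only [hF, Fin.init_snoc, Fin.snoc_last]
      exact h3
    · intro x hx
      rw [hBi hx]
      simp only [hF, Fin.init_snoc, Fin.snoc_last]
      ring
  have e : KZ.of S - KZ.of N - KZ.of Bφ = (KZ.of S - KZ.of N - KZ.of P) + (KZ.of P - KZ.of Bφ) := by
    abel
  rw [e]
  exact add_mem hPrel hNL

/-- **`RegTorusProductMixed₁` — the mixed orientation `u ≥ 1 ≥ w > 0`, `uw ≥ 1`, PROVED.**
With `R = [{1≤t≤uw}, dk]`, `R₁ = [{1≤t≤u}, dk]`, the REVERSED band `R₂ = [{w≤s≤1}, dk]` (so that the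
oriented cell `P(w) = −[R₂]`) and `B = [G, d·ρ_m(u,w)]`:  `[R] − [R₁] + [R₂] − [B] ∈ KZ.relations`. -/
theorem regTorusProductMixed₁ {b m : ℕ} {G : Set (Fin b → ℝ)} {d u w : (Fin b → ℝ) → ℝ}
    (hGo : IsOpen G) (hG : IsSemialgebraic ℚ G) (hd : IsSemialgebraicFunOn ℚ G d)
    (hu : IsSemialgebraicFunOn ℚ G u) (hw : IsSemialgebraicFunOn ℚ G w)
    (hud : DifferentiableOn ℝ u G) (hu1 : ∀ x ∈ G, 1 ≤ u x) (hw0 : ∀ x ∈ G, 0 < w x)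
    (hw1 : ∀ x ∈ G, w x ≤ 1) (huw : ∀ x ∈ G, 1 ≤ u x * w x)
    (R R₁ R₂ : KZ.IntegralRep (b + 1)) (B : KZ.IntegralRep b)
    (hRd : R.domain = KZlog.band G (fun _ => 1) (fun x => u x * w x))
    (hRi : EqOn R.integrand
      (fun z => d (Fin.init z) * ((z (Fin.last b) - 1) ^ m / z (Fin.last b))) R.domain)
    (hR₁d : R₁.domain = KZlog.band G (fun _ => 1) u)
    (hR₁i : EqOn R₁.integrand
      (fun z => d (Fin.init z) * ((z (Fin.last b) - 1) ^ m / z (Fin.last b))) R₁.domain)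
    (hR₂d : R₂.domain = KZlog.band G w (fun _ => 1))
    (hR₂i : EqOn R₂.integrand
      (fun z => d (Fin.init z) * ((z (Fin.last b) - 1) ^ m / z (Fin.last b))) R₂.domain)
    (hBd : B.domain = G) (hBi : EqOn B.integrand (fun x => d x * rho m (u x) (w x)) B.domain) :
    KZ.of R - KZ.of R₁ + KZ.of R₂ - KZ.of B ∈ KZ.relations := by
  have huwf : IsSemialgebraicFunOn ℚ G (fun x => u x * w x) := IsSemialgebraicFunOn.mul_holds hu hw
  have hc1 : IsSemialgebraicFunOn ℚ G (fun _ => (1 : ℝ)) := by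
    simpa using isSemialgebraicFunOn_ratCast hG 1
  have hu0 : ∀ x ∈ G, 0 < u x := fun x hx => one_pos.trans_le (hu1 x hx)
  have hle : ∀ x ∈ G, u x * w x ≤ u x := fun x hx =>
    mul_le_of_le_one_right (hu0 x hx).le (hw1 x hx)
  -- 1. split `R₁` at `t = u w`:  `R₁ = Rl ∪ M`, `Rl = [1, uw]`, `M = [uw, u]`
  have hbl : IsSemialgebraic ℚ (KZlog.band G (fun _ => 1) fun x => u x * w x) :=
    KZlog.isSemialgebraic_band hc1 huwf
  have hbM : IsSemialgebraic ℚ (KZlog.band G (fun x => u x * w x) u) :=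
    KZlog.isSemialgebraic_band huwf hu
  have hsubl : KZlog.band G (fun _ => 1) (fun x => u x * w x) ⊆ R₁.domain := fun z hz =>
    hR₁d ▸ ⟨hz.1, hz.2.1, hz.2.2.trans (hle _ hz.1)⟩
  have hsubM : KZlog.band G (fun x => u x * w x) u ⊆ R₁.domain := fun z hz =>
    hR₁d ▸ ⟨hz.1, (huw _ hz.1).trans hz.2.1, hz.2.2⟩
  set Rl := R₁.restrict _ hbl hsubl with hRl
  set M := R₁.restrict _ hbM hsubM with hM
  have h1 : KZ.of R₁ - KZ.of Rl - KZ.of M ∈ KZ.relations := by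
    refine KZ.domainAddRel_subset_relations ⟨b + 1, R₁, Rl, M, ?_, ?_, fun _ _ => rfl,
      fun _ _ => rfl, rfl⟩
    · rw [hR₁d, hRl, hM, KZ.IntegralRep.domain_restrict, KZ.IntegralRep.domain_restrict]
      ext z
      simp only [KZlog.band, mem_setOf_eq, mem_union]
      constructor
      · rintro ⟨hx, h1, h2⟩
        rcases le_total (z (Fin.last b)) (u (Fin.init z) * w (Fin.init z)) with h | h
        · exact Or.inl ⟨hx, h1, h⟩
        · exact Or.inr ⟨hx, h, h2⟩
      · rintro (⟨hx, h1, h2⟩ | ⟨hx, h1, h2⟩)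
        · exact ⟨hx, h1, h2.trans (hle _ hx)⟩
        · exact ⟨hx, (huw _ hx).trans h1, h2⟩
    · refine measure_mono_null (fun z hz => ?_) (KZ.volume_graph_eq_zero huwf)
      rw [hRl, hM, KZ.IntegralRep.domain_restrict, KZ.IntegralRep.domain_restrict] at hz
      exact ⟨hz.1.1, le_antisymm hz.1.2.2 hz.2.2.1⟩
  have h2 : KZ.of Rl - KZ.of R ∈ KZ.relations :=
    KZ.of_sub_of_mem_relations_of_eqOn (by rw [hRd, hRl, KZ.IntegralRep.domain_restrict])
      fun z hz => by
        rw [hRl, KZ.IntegralRep.domain_restrict] at hz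
        rw [hRl, KZ.IntegralRep.integrand_restrict, hR₁i (hsubl hz), hRi (hRd ▸ hz)]
  -- 2. the rescaled band `S` on `[w, 1]` and rule 2: `[S] − [M] ∈ relations`
  obtain ⟨S, hSd, hSi⟩ := exists_scaledRep (m := m) hG hd hu hw hc1 hu0 hw0 hw1 R₁ hR₁d hR₁i
    (fun _ _ => one_pos) huw (fun x _ => by simp)
  have hSi' : EqOn S.integrand
      (fun z => d (Fin.init z) * ((u (Fin.init z) * z (Fin.last b) - 1) ^ m / z (Fin.last b)))
      S.domain := fun z _ => by rw [hSi]
  have h3 : KZ.of S - KZ.of M ∈ KZ.relations :=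
    of_scaled_sub_of_mem_relations hGo hG hu hud hu0 hw0 S M hSd hSi'
      (by rw [hM, KZ.IntegralRep.domain_restrict]) (fun _ _ => rfl) (fun x _ => by simp)
      fun z hz => by
        rw [hM, KZ.IntegralRep.domain_restrict] at hz
        rw [hM, KZ.IntegralRep.integrand_restrict, hR₁i (hsubM hz)]
  -- 3. fold the polynomial band `S − R₂` to the base: it lands on `−B`
  have h4 : KZ.of S - KZ.of R₂ - KZ.of B.neg ∈ KZ.relations := by
    refine polyBand_fold hd hu hw hc1 hw0 hw1 hu0 S R₂ B.neg hSd hSi' hR₂d hR₂i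
      (by rw [← hBd]; rfl) fun x hx => ?_
    have hx' : x ∈ B.domain := hx
    show -B.integrand x = _
    rw [hBi hx']
    simp only [rho, mul_one, polyLog_one]
    ring
  have h5 : KZ.of B + KZ.of B.neg ∈ KZ.relations :=
    KZ.of_add_of_mem_relations_of_eqOn_neg rfl fun _ _ => rfl
  -- 4. assemble
  have e : KZ.of R - KZ.of R₁ + KZ.of R₂ - KZ.of B =
      -(KZ.of R₁ - KZ.of Rl - KZ.of M) - (KZ.of Rl - KZ.of R) + (KZ.of S - KZ.of M) -
        (KZ.of S - KZ.of R₂ - KZ.of B.neg) - (KZ.of B + KZ.of B.neg) := by abel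
  rw [e]
  exact sub_mem (sub_mem (add_mem (sub_mem (neg_mem h1) h2) h3) h4) h5

/-! ### §3f The remaining sign patterns — PROVED.  Sign patterns of `(u−1, w−1, uw−1)`:
`(+,+,+)` = `regTorusProductPos`, `(+,−,+)` = `regTorusProductMixed₁`, `(+,−,−)` = `regTorusProductMixed₂`,
`(−,−,−)` = `regTorusProductNeg`, `(−,+,−)` = `regTorusProductMixed₃`, `(−,+,+)` = `regTorusProductMixed₄`
(the patterns `(+,+,−)`, `(−,−,+)` are empty).  Convention: a cell with parameter `v ≤ 1` is represented by the
REVERSED closed band `[{v ≤ s ≤ 1}, d(s−1)^m/s]` and enters with the opposite sign. -/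

/-- The kernel `d(x)·((u(x)s−1)^m/s)` is `ℚ`-semialgebraic on a set over `G` avoiding `s = 0`. -/
theorem isSemialgebraicFunOn_scaledKernel {b : ℕ} (m : ℕ) {G : Set (Fin b → ℝ)}
    {Bd : Set (Fin (b + 1) → ℝ)} {d u : (Fin b → ℝ) → ℝ} (hBd : IsSemialgebraic ℚ Bd)
    (hsub : Bd ⊆ {z | Fin.init z ∈ G}) (hd : IsSemialgebraicFunOn ℚ G d)
    (hu : IsSemialgebraicFunOn ℚ G u) (hs0 : ∀ z ∈ Bd, z (Fin.last b) ≠ 0) :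
    IsSemialgebraicFunOn ℚ Bd
      (fun z => d (Fin.init z) * ((u (Fin.init z) * z (Fin.last b) - 1) ^ m / z (Fin.last b))) := by
  have hdI : IsSemialgebraicFunOn ℚ Bd (fun z => d (Fin.init z)) := hd.comp_init.mono hsub hBd
  have huI : IsSemialgebraicFunOn ℚ Bd (fun z => u (Fin.init z)) := hu.comp_init.mono hsub hBd
  have hsI : IsSemialgebraicFunOn ℚ Bd (fun z => z (Fin.last b)) := isSemialgebraicFunOn_apply hBd _
  have hlin : IsSemialgebraicFunOn ℚ Bd (fun z => u (Fin.init z) * z (Fin.last b) - 1) :=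
    (IsSemialgebraicFunOn.sub_holds (IsSemialgebraicFunOn.mul_holds huI hsI)
      (isSemialgebraicFunOn_ratCast hBd 1)).congr fun z _ => by simp
  have hpow := isSemialgebraicFunOn_pow' hBd hlin m
  have hinv : IsSemialgebraicFunOn ℚ Bd (fun z => 1 / z (Fin.last b)) :=
    (isSemialgebraicFunOn_aeval_div_aeval hBd 1 (MvPolynomial.X (Fin.last b)) fun z hz => by
      simpa using hs0 z hz).congr fun z _ => by simp
  exact (IsSemialgebraicFunOn.mul_holds hdI (IsSemialgebraicFunOn.mul_holds hpow hinv)).congr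
    fun z _ => by simp [div_eq_mul_inv]

end CylLog
end RegularisedLogLayer
end Summit.KontsevichZagierPeriods.RootDecompRelativeModAbsolute.Rung30571
end
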